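import Summits.QuantumFields.YangMills.Theorems.PencilRigidityWeakCouplingHypercubicLimitStubPressureForcesGap
import Summits.QuantumFields.YangMills.Theorems.PencilRigidityWeakCouplingHypercubicLimitStubRateBookkeeping
import Summits.QuantumFields.YangMills.Theorems.PencilRigidityWeakCouplingHypercubicLimitStubPerpContraction
import Summits.QuantumFields.YangMills.Theorems.PencilRigidityWeakCouplingHypercubicLimitStubTraceCluster
import Summits.QuantumFields.YangMills.Theorems.PencilRigidityWeakCouplingHypercubicLimitStubTransferRepresentation
import Literature.MathematicalPhysics.QuantumFieldTheory.YangMillsOS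
import Literature.MathematicalPhysics.QuantumFieldTheory.WilsonTransferKernel
import Literature.MathematicalPhysics.QuantumLattice.WilsonBlockHeatBathLightCone2
import HarnessLib

/-!
# Cold pressure forces volume-uniform clustering (line `Sketch` of crux `WeakCouplingHypercubicLimit`,
# stmt-QuantumFields-16120): the infrared lever as a stand-alone theorem

The line `trace-norm-cold-pressure` derives the all-observable, volume-uniform lattice mass-gap clause
`HasLatticeMassGap r sch Δ` of the crux from ONE real inequality per cold torus shape — the COLD-PRESSURE
BOUND on the trace excess `traceExcess r.ρ β (2S+1) m = Z_β(m × (2S+1)³)/λ₊^m − 1` of Wilson's transfer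
semigroup — by the transfer-matrix representation of torus expectations (`stub_transferRepresentation`,
p125801) and finite-dimensional trace inequalities (`stub_perpContraction` p121560, `stub_traceCluster`
p121610, `stub_rateBookkeeping` p121384).  Until now that derivation lived only inside the composition
`WeakCouplingHypercubicLimit_of` of the skeleton, instantiated along a scheme.  This file factors it as
three importable statements:

* `abs_latticeConnectedCorr_le_of_coldPressure` — **fixed coupling, explicit constants, scheme-free**:
  for a compact group `G`, a faithful unitary `r`, bounded gauge-invariant local observables `A`, `B`
  (bounds `C_A`, `C_B`) there is a time-width `w` (from the supports only) such that at every `β ≥ 0`, for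
  every rate `μ ∈ [0, 1]`, `C₀ ≥ 0`, `K` and volume threshold `L`, the volume floor
  `C₀ (2S+1)³ e^{−μ S/2} ≤ K` (`S ≥ L`) and the cold-pressure bound
  `traceExcess r.ρ β (2S+1) (m+2) ≤ C₀ (2S+1)³ e^{−μ (m+2)}` (`S ≥ L`, `S + 1 ≤ 2(m+2)`) give
  `|⟨A; τ_n B⟩_{β,(2S+1)⁴}| ≤ max(C_A C_B e^{2w}(2 + 4K + K²), 2 C_A C_B e^{2w}) · e^{−μ n}` for all
  `S ≥ L`, `n ≤ S`.
* `uniformClustering_of_coldPressure` — **lattice units** (the socket for the weak-coupling lattice-gap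
  items of the sibling routes, e.g. `ContractibleFibre.UniformLatticeGap`, `ModularSelfDualFold.WeakCouplingLatticeGap`,
  `RandomConstraintAnnealing.TubeGapLatticeLeg`, whose bodies have exactly this conclusion): at a fixed
  `β ≥ 0`, a cold-pressure bound with ANY rate `g > 0` beyond some torus size yields
  `∃ m > 0, ∃ S₂, ∀ A B, ∃ C, ∀ S n, S₂ ≤ S → n ≤ S → |⟨A; τ_n B⟩| ≤ C e^{−m n}` (`m = min g 1`; the
  volume floor is free in lattice units because `(2S+1)³ e^{−m S/2} → 0`).
* `hasLatticeMassGap_of_coldPressure` — **along a scheme** (the IR half of the skeleton's composition):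
  the cold-pressure bound and the volume floor with rate `Δ a_k`, eventually in `k`, give
  `HasLatticeMassGap r sch Δ`.

No new definitions; group-blind (every compact `G` with a lattice representation, every `β ≥ 0`).
[folklore: Osterwalder–Seiler 1978 §3 transfer-matrix formalism + finite-dimensional spectral bookkeeping]
-/

noncomputable section

open scoped BigOperators Topology InnerProductSpace
open MeasureTheory Filter
open Literature.MathematicalPhysics.QuantumFieldTheory Literature.MathematicalPhysics.QuantumLattice

namespace Summit.QuantumFields.YangMills.Theorems.WeakCouplingHypercubicLimit.TraceNormColdPressure

variable {G : Type} [Group G] [TopologicalSpace G] [IsTopologicalGroup G] [CompactSpace G]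
  [MeasurableSpace G] [BorelSpace G]

/-- **Cold pressure forces clustering — fixed coupling, explicit constants.**  For bounded
gauge-invariant local observables `A`, `B` there is a time-width `w` such that at every coupling
`β ≥ 0`, every rate `μ ∈ [0,1]`, constants `C₀ ≥ 0`, `K`, and threshold `L`: the volume floor
`C₀ (2S+1)³ e^{−μ S/2} ≤ K` for `S ≥ L` and the cold-pressure bound
`traceExcess r.ρ β (2S+1) (m+2) ≤ C₀ (2S+1)³ e^{−μ (m+2)}` for `S ≥ L`, `S + 1 ≤ 2 (m+2)` imply
`|latticeConnectedCorr r.ρ β (2S+1) A B n| ≤ max(C_A C_B e^{2w}(2+4K+K²), 2 C_A C_B e^{2w}) e^{−μ n}`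
for all `S ≥ L` and `n ≤ S`.  Proof: a priori bound when `n ≤ w` or `S < 2w`; otherwise on each finite
transfer model of `stub_transferRepresentation` the cold-pressure bound gives the contraction rate `e^{−μ}`
on `Ω^⊥` (`stub_perpContraction`), `stub_traceCluster` bounds the normalised connected trace, `ε → 0`,
and `stub_rateBookkeeping` sums the six terms. [folklore] -/
theorem abs_latticeConnectedCorr_le_of_coldPressure (r : LatticeRep G) (A B : YMSpecies G)
    {CA CB : ℝ} (hCA : ∀ U, |A.F U| ≤ CA) (hCB : ∀ U, |B.F U| ≤ CB) :
    ∃ w : ℕ, ∀ (β : ℝ), 0 ≤ β → ∀ (μ C₀ K : ℝ), 0 ≤ μ → μ ≤ 1 → 0 ≤ C₀ → ∀ L : ℕ,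
      (∀ S : ℕ, L ≤ S → C₀ * ((2 * S + 1 : ℕ) : ℝ) ^ 3 * Real.exp (-(μ * S / 2)) ≤ K) →
      (∀ S : ℕ, L ≤ S → ∀ m : ℕ, S + 1 ≤ 2 * (m + 2) →
        traceExcess r.ρ β (2 * S + 1) (m + 2) ≤
          C₀ * ((2 * S + 1 : ℕ) : ℝ) ^ 3 * Real.exp (-(μ * ((m + 2 : ℕ) : ℝ)))) →
      ∀ S n : ℕ, L ≤ S → n ≤ S →
        |latticeConnectedCorr r.ρ β (2 * S + 1) A.F B.F n| ≤
          max (CA * CB * Real.exp (2 * w) * (2 + 4 * K + K ^ 2)) (2 * (CA * CB) * Real.exp (2 * w)) *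
            Real.exp (-(μ * n)) := by
  -- adapted from the composition `WeakCouplingHypercubicLimit_of` of Cruxes/WeakCouplingHypercubicLimit/Lines/Sketch.lean (r6)
  have hCA0 : 0 ≤ CA := le_trans (abs_nonneg _) (hCA 1)
  have hCB0 : 0 ≤ CB := le_trans (abs_nonneg _) (hCB 1)
  obtain ⟨w, hw⟩ := stub_transferRepresentation G r A B
  refine ⟨w, ?_⟩
  intro β hβ μ C₀ K hμ0 hμ1 hC₀ L hK hP S n hS hn
  have hexp0 : 0 ≤ Real.exp (-(μ * n)) := Real.exp_nonneg _
  by_cases hcase : w < n ∧ 2 * w ≤ S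
  · -- finite transfer models
    have hwn : w < n := hcase.1
    -- the trace-excess function, made total and nonnegative
    set X : ℕ → ℝ := fun m => max 0 (traceExcess r.ρ β (2 * S + 1) (m - 2 + 2)) with hXdef
    have hX0 : ∀ m, 0 ≤ X m := fun m => le_max_left _ _
    have hXP : ∀ m : ℕ, S + 1 ≤ 2 * m →
        X m ≤ C₀ * ((2 * S + 1 : ℕ) : ℝ) ^ 3 * Real.exp (-(μ * m)) := by
      intro m hm
      have hm2 : S + 1 ≤ 2 * (m - 2 + 2) := by omega
      have h1 := hP S hS (m - 2) hm2
      have hle : (m : ℝ) ≤ ((m - 2 + 2 : ℕ) : ℝ) := by exact_mod_cast (by omega : m ≤ m - 2 + 2)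
      have hexp : Real.exp (-(μ * ((m - 2 + 2 : ℕ) : ℝ))) ≤ Real.exp (-(μ * m)) :=
        Real.exp_le_exp.2 (by nlinarith)
      have hC₀V : 0 ≤ C₀ * ((2 * S + 1 : ℕ) : ℝ) ^ 3 := by positivity
      exact max_le (by positivity) (h1.trans (mul_le_mul_of_nonneg_left hexp hC₀V))
    have hmod := hw β hβ CA CB hCA hCB S n hn hwn hcase.2
    set V : ℝ := ((2 * S + 1 : ℕ) : ℝ) ^ 3 with hVdef
    have hV : 0 < V := by positivity
    have key : |latticeConnectedCorr r.ρ β (2 * S + 1) A.F B.F n| ≤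
        CA * CB * (Real.exp (-μ) ^ (n - w) * (1 + X (2 * S + 1 - n - w)) +
          Real.exp (-μ) ^ (2 * S + 1 - n - w) + X (2 * S + 1) + X (2 * S + 1 - w) + X (2 * S + 1 - w) +
          X (2 * S + 1 - w) * X (2 * S + 1 - w)) := by
      refine le_of_forall_pos_le_add fun ε hε => ?_
      obtain ⟨d, T, Ao, Bo, Ω, hT, hΩ, hTΩ, hcon, hAo, hBo, hXT', hclose⟩ := hmod ε hε
      have hXT : ∀ m : ℕ, 2 ≤ m →
          LinearMap.trace ℝ _ (↑(T ^ m) : EuclideanSpace ℝ (Fin d) →ₗ[ℝ] EuclideanSpace ℝ (Fin d)) - 1 ≤ X m := by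
        intro m hm
        have h := hXT' (m - 2)
        have e : m - 2 + 2 = m := by omega
        have hpow : T ^ m = T ^ (m - 2 + 2) := by rw [e]
        rw [hpow]
        exact h.trans (le_max_right _ _)
      -- the contraction rate on Ω^⊥ from the cold-pressure bound (S2)
      have hr : ∀ v, inner ℝ Ω v = 0 → ‖T v‖ ≤ Real.exp (-μ) * ‖v‖ :=
        stub_perpContraction d T Ω μ V C₀ (S + 1) hT hΩ hTΩ hcon hV (fun m hm => by
          calc LinearMap.trace ℝ _ (↑(T ^ m) : EuclideanSpace ℝ (Fin d) →ₗ[ℝ] EuclideanSpace ℝ (Fin d)) - 1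
              ≤ X m := hXT m (by omega)
            _ ≤ C₀ * V * Real.exp (-(μ * m)) := hXP m (by omega)
            _ = V * C₀ * Real.exp (-(μ * m)) := by ring)
      -- the trace cluster bound on the model (S3)
      have h1a : 2 ≤ 2 * S + 1 - n - w := by omega
      have h1N : 2 ≤ 2 * S + 1 := by omega
      have h1p : 2 ≤ 2 * S + 1 - w := by omega
      have htc := stub_traceCluster d T Ao Bo Ω (Real.exp (-μ)) (X (2 * S + 1 - n - w)) (X (2 * S + 1))
        (X (2 * S + 1 - w)) (X (2 * S + 1 - w)) (2 * S + 1 - n - w) (n - w) (2 * S + 1 - w)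
        (2 * S + 1 - w) (2 * S + 1) hT hΩ hTΩ (Real.exp_nonneg _)
        (Real.exp_le_one_iff.mpr (by linarith)) hr (hXT _ h1a) (hXT _ h1N) (hXT _ h1p) (hXT _ h1p)
      -- monotonicity in the norms
      have hbr0 : 0 ≤ Real.exp (-μ) ^ (n - w) * (1 + X (2 * S + 1 - n - w)) +
          Real.exp (-μ) ^ (2 * S + 1 - n - w) + X (2 * S + 1) + X (2 * S + 1 - w) + X (2 * S + 1 - w) +
          X (2 * S + 1 - w) * X (2 * S + 1 - w) := by
        have := hX0 (2 * S + 1 - n - w); have := hX0 (2 * S + 1); have := hX0 (2 * S + 1 - w)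
        positivity
      have hnorm : ‖Ao‖ * ‖Bo‖ ≤ CA * CB :=
        mul_le_mul hAo hBo (norm_nonneg _) hCA0
      have hmodel := htc.trans (mul_le_mul_of_nonneg_right hnorm hbr0)
      have htri := abs_sub_abs_le_abs_sub
        (latticeConnectedCorr r.ρ β (2 * S + 1) A.F B.F n)
        (LinearMap.trace ℝ _ (↑(T ^ (2 * S + 1 - n - w) * Ao * T ^ (n - w) * Bo) : EuclideanSpace ℝ (Fin d) →ₗ[ℝ] EuclideanSpace ℝ (Fin d)) / LinearMap.trace ℝ _ (↑(T ^ (2 * S + 1)) : EuclideanSpace ℝ (Fin d) →ₗ[ℝ] EuclideanSpace ℝ (Fin d)) - LinearMap.trace ℝ _ (↑(T ^ (2 * S + 1 - w) * Ao) : EuclideanSpace ℝ (Fin d) →ₗ[ℝ] EuclideanSpace ℝ (Fin d)) / LinearMap.trace ℝ _ (↑(T ^ (2 * S + 1)) : EuclideanSpace ℝ (Fin d) →ₗ[ℝ] EuclideanSpace ℝ (Fin d)) * (LinearMap.trace ℝ _ (↑(T ^ (2 * S + 1 - w) * Bo) : EuclideanSpace ℝ (Fin d) →ₗ[ℝ]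 EuclideanSpace ℝ (Fin d)) / LinearMap.trace ℝ _ (↑(T ^ (2 * S + 1)) : EuclideanSpace ℝ (Fin d) →ₗ[ℝ] EuclideanSpace ℝ (Fin d))))
      linarith
    calc |latticeConnectedCorr r.ρ β (2 * S + 1) A.F B.F n|
        ≤ _ := key
      _ ≤ CA * CB * Real.exp (2 * w) * (2 + 4 * K + K ^ 2) * Real.exp (-(μ * n)) :=
          stub_rateBookkeeping μ C₀ V K CA CB X S n w hμ0 hμ1 hCA0 hCB0 hcase.1.le hn hcase.2 hX0 hXP (hK S hS)
      _ ≤ _ := mul_le_mul_of_nonneg_right (le_max_left _ _) hexp0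
  · -- a priori bound
    have hap := WilsonBlockHeatBath.abs_latticeConnectedCorr_le_two_mul r β (2 * S + 1) hCA hCB n
    have hμn : μ * n ≤ 2 * w := by
      have hn2 : (n : ℝ) ≤ 2 * w := by
        rcases not_and_or.mp hcase with h | h
        · have : n ≤ w := Nat.le_of_not_lt h
          exact_mod_cast (by omega : n ≤ 2 * w)
        · have : S < 2 * w := Nat.lt_of_not_le h
          exact_mod_cast (by omega : n ≤ 2 * w)
      calc μ * n ≤ 1 * n := mul_le_mul_of_nonneg_right hμ1 (Nat.cast_nonneg _)
        _ = n := one_mul _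
        _ ≤ 2 * w := hn2
    have hone : 1 ≤ Real.exp (2 * w) * Real.exp (-(μ * n)) := by
      rw [← Real.exp_add]
      exact Real.one_le_exp (by linarith)
    have hCC : 0 ≤ 2 * (CA * CB) := by positivity
    calc |latticeConnectedCorr r.ρ β (2 * S + 1) A.F B.F n|
        ≤ 2 * (CA * CB) := hap
      _ ≤ 2 * (CA * CB) * (Real.exp (2 * w) * Real.exp (-(μ * n))) :=
          le_mul_of_one_le_right hCC hone
      _ = 2 * (CA * CB) * Real.exp (2 * w) * Real.exp (-(μ * n)) := by ring
      _ ≤ _ := mul_le_mul_of_nonneg_right (le_max_right _ _) hexp0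

/-- **Cold pressure forces clustering — lattice units.**  At a fixed coupling `β ≥ 0`, if the cold
tori beyond some size `S₁` obey the cold-pressure bound with SOME rate `g > 0` in lattice units,
`traceExcess r.ρ β (2S+1) (m+2) ≤ C₀ (2S+1)³ e^{−g (m+2)}` (`S ≥ S₁`, `S + 1 ≤ 2 (m+2)`), then every pair
of gauge-invariant local observables clusters exponentially at the rate `min g 1`, uniformly in the
volume: `∃ m > 0, ∃ S₂, ∀ A B, ∃ C, ∀ S n, S₂ ≤ S → n ≤ S → |⟨A; τ_n B⟩_{β,(2S+1)⁴}| ≤ C e^{−m n}` — the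
conclusion of the weak-coupling lattice-gap items of the sibling routes at that `β` (the volume floor is
free here: `(2S+1)³ e^{−m S/2} → 0`). [folklore] -/
theorem uniformClustering_of_coldPressure (r : LatticeRep G) {β : ℝ} (hβ : 0 ≤ β) {g C₀ : ℝ}
    (hg : 0 < g) (hC₀ : 0 ≤ C₀) {S₁ : ℕ}
    (hP : ∀ S : ℕ, S₁ ≤ S → ∀ m : ℕ, S + 1 ≤ 2 * (m + 2) →
      traceExcess r.ρ β (2 * S + 1) (m + 2) ≤
        C₀ * ((2 * S + 1 : ℕ) : ℝ) ^ 3 * Real.exp (-(g * ((m + 2 : ℕ) : ℝ)))) :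
    ∃ m : ℝ, 0 < m ∧ ∃ S₂ : ℕ, ∀ A B : YMSpecies G, ∃ C : ℝ, ∀ S n : ℕ, S₂ ≤ S → n ≤ S →
      |latticeConnectedCorr r.ρ β (2 * S + 1) A.F B.F n| ≤ C * Real.exp (-(m * n)) := by
  set μ : ℝ := min g 1 with hμdef
  have hμ0 : 0 < μ := lt_min hg one_pos
  have hμ1 : μ ≤ 1 := min_le_right _ _
  have hμg : μ ≤ g := min_le_left _ _
  -- the volume floor is eventually free in lattice units
  have hfloor : ∀ᶠ S : ℕ in atTop, C₀ * ((2 * S + 1 : ℕ) : ℝ) ^ 3 * Real.exp (-(μ * S / 2)) ≤ 1 := by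
    -- `u ↦ u³ e^{-u}` tends to `0`; `u = μ S / 2`
    have hu : Tendsto (fun S : ℕ => μ * (S : ℝ) / 2) atTop atTop := by
      have h1 : Tendsto (fun S : ℕ => (S : ℝ)) atTop atTop := tendsto_natCast_atTop_atTop
      have h2 : Tendsto (fun S : ℕ => (S : ℝ) * (μ / 2)) atTop atTop :=
        h1.atTop_mul_const (by positivity)
      refine h2.congr fun S => ?_
      ring
    have h3 := (Real.tendsto_pow_mul_exp_neg_atTop_nhds_zero 3).comp hu
    have h4 : Tendsto (fun S : ℕ => C₀ * 27 * (2 / μ) ^ 3 * ((μ * (S : ℝ) / 2) ^ 3 * Real.exp (-(μ * S / 2))))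
        atTop (𝓝 (C₀ * 27 * (2 / μ) ^ 3 * 0)) := h3.const_mul _
    rw [mul_zero] at h4
    have h5 : ∀ᶠ S : ℕ in atTop, C₀ * 27 * (2 / μ) ^ 3 * ((μ * (S : ℝ) / 2) ^ 3 * Real.exp (-(μ * S / 2))) ≤ 1 :=
      (h4.eventually (ge_mem_nhds one_pos))
    filter_upwards [h5, eventually_ge_atTop 1] with S hS hS1
    have hS1R : (1 : ℝ) ≤ S := by exact_mod_cast hS1
    have hcube : ((2 * S + 1 : ℕ) : ℝ) ^ 3 ≤ 27 * (2 / μ) ^ 3 * (μ * (S : ℝ) / 2) ^ 3 := by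
      have hid : 27 * (2 / μ) ^ 3 * (μ * (S : ℝ) / 2) ^ 3 = (3 * (S : ℝ)) ^ 3 := by
        field_simp
        ring
      rw [hid]
      have hle : ((2 * S + 1 : ℕ) : ℝ) ≤ 3 * (S : ℝ) := by push_cast; linarith
      exact pow_le_pow_left₀ (by positivity) hle 3
    calc C₀ * ((2 * S + 1 : ℕ) : ℝ) ^ 3 * Real.exp (-(μ * S / 2))
        ≤ C₀ * (27 * (2 / μ) ^ 3 * (μ * (S : ℝ) / 2) ^ 3) * Real.exp (-(μ * S / 2)) := by
          gcongr
      _ = C₀ * 27 * (2 / μ) ^ 3 * ((μ * (S : ℝ) / 2) ^ 3 * Real.exp (-(μ * S / 2))) := by ring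
      _ ≤ 1 := hS
  obtain ⟨S₀, hS₀⟩ := eventually_atTop.1 hfloor
  refine ⟨μ, hμ0, max S₁ S₀, fun A B => ?_⟩
  obtain ⟨CA, hCA⟩ := A.bounded
  obtain ⟨CB, hCB⟩ := B.bounded
  obtain ⟨w, hw⟩ := abs_latticeConnectedCorr_le_of_coldPressure r A B hCA hCB
  refine ⟨max (CA * CB * Real.exp (2 * w) * (2 + 4 * 1 + 1 ^ 2)) (2 * (CA * CB) * Real.exp (2 * w)), ?_⟩
  intro S n hS hn
  have hS1 : S₁ ≤ S := le_trans (le_max_left _ _) hS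
  have hS0' : S₀ ≤ S := le_trans (le_max_right _ _) hS
  refine hw β hβ μ C₀ 1 hμ0.le hμ1 hC₀ (max S₁ S₀) (fun S' hS' => hS₀ S' (le_trans (le_max_right _ _) hS'))
    (fun S' hS' m hm => ?_) S n hS hn
  have h1 := hP S' (le_trans (le_max_left _ _) hS') m hm
  have hexp : Real.exp (-(g * ((m + 2 : ℕ) : ℝ))) ≤ Real.exp (-(μ * ((m + 2 : ℕ) : ℝ))) :=
    Real.exp_le_exp.2 (by
      have : (0 : ℝ) ≤ ((m + 2 : ℕ) : ℝ) := Nat.cast_nonneg _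
      nlinarith)
  have hC₀V : 0 ≤ C₀ * ((2 * S' + 1 : ℕ) : ℝ) ^ 3 := by positivity
  exact h1.trans (mul_le_mul_of_nonneg_left hexp hC₀V)

/-- **Cold pressure forces the lattice mass-gap clause along a scheme** (the IR half of the line's
composition): if, eventually in `k`, the tori of the scheme obey the volume floor
`C₀ (2S+1)³ e^{−Δ a_k S/2} ≤ K` (`S ≥ L_k`) and the cold-pressure bound
`traceExcess r.ρ β_k (2S+1) (m+2) ≤ C₀ (2S+1)³ e^{−Δ a_k (m+2)}` (`S ≥ L_k`, `S + 1 ≤ 2(m+2)`), with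
`β_k ≥ 0` eventually (automatic at weak coupling) and `Δ > 0`, then `HasLatticeMassGap r sch Δ`. [folklore] -/
theorem hasLatticeMassGap_of_coldPressure {ι : Type} (r : LatticeRep G) (sch : SpeciesScheme ι)
    (hβ : ∀ᶠ k in atTop, 0 ≤ sch.β k) {Δ C₀ K : ℝ} (hΔ : 0 < Δ) (hC₀ : 0 ≤ C₀)
    (hK : ∀ᶠ k in atTop, ∀ S : ℕ, sch.L k ≤ S →
      C₀ * ((2 * S + 1 : ℕ) : ℝ) ^ 3 * Real.exp (-(Δ * sch.a k * S / 2)) ≤ K)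
    (hP : ∀ᶠ k in atTop, ∀ S : ℕ, sch.L k ≤ S → ∀ m : ℕ, S + 1 ≤ 2 * (m + 2) →
      traceExcess r.ρ (sch.β k) (2 * S + 1) (m + 2) ≤
        C₀ * ((2 * S + 1 : ℕ) : ℝ) ^ 3 * Real.exp (-(Δ * sch.a k * ((m + 2 : ℕ) : ℝ)))) :
    HasLatticeMassGap r sch Δ := by
  intro A B
  obtain ⟨CA, hCA⟩ := A.bounded
  obtain ⟨CB, hCB⟩ := B.bounded
  obtain ⟨w, hw⟩ := abs_latticeConnectedCorr_le_of_coldPressure r A B hCA hCB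
  refine ⟨max (CA * CB * Real.exp (2 * w) * (2 + 4 * K + K ^ 2)) (2 * (CA * CB) * Real.exp (2 * w)), ?_⟩
  have ha1 : ∀ᶠ k in atTop, Δ * sch.a k ≤ 1 := by
    have h := (sch.tendsto_a.const_mul Δ)
    rw [mul_zero] at h
    exact (h.eventually (gt_mem_nhds one_pos)).mono fun k hk => hk.le
  filter_upwards [hK, hP, ha1, hβ] with k hKk hPk hak hβk S hS n hn
  have hμ0 : 0 ≤ Δ * sch.a k := mul_nonneg hΔ.le (sch.a_pos k).le
  have htarget : Real.exp (-(Δ * (sch.a k * n))) = Real.exp (-(Δ * sch.a k * n)) := by rw [mul_assoc]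
  rw [htarget]
  exact hw (sch.β k) hβk (Δ * sch.a k) C₀ K hμ0 hak hC₀ (sch.L k) (hKk) (hPk) S n hS hn

/-- `stub_latticeGapOfColdPressure` (the registered IR-lever stub of line `Sketch`, skeleton r7) — **cold
pressure forces the lattice mass-gap clause along a scheme**, in the binder form registered on the crux item
(label type `YMSpecies G`): `hasLatticeMassGap_of_coldPressure`. [folklore] -/
theorem stub_latticeGapOfColdPressure :
    ∀ (G : Type) [Group G] [TopologicalSpace G] [IsTopologicalGroup G] [CompactSpace G]
      [MeasurableSpace G] [BorelSpace G] (r : LatticeRep G) (sch : SpeciesScheme (YMSpecies G)) (Δ C₀ K : ℝ),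
      (∀ᶠ k in Filter.atTop, 0 ≤ sch.β k) → 0 < Δ → 0 ≤ C₀ →
      (∀ᶠ k in Filter.atTop, ∀ S : ℕ, sch.L k ≤ S →
        C₀ * ((2 * S + 1 : ℕ) : ℝ) ^ 3 * Real.exp (-(Δ * sch.a k * S / 2)) ≤ K) →
      (∀ᶠ k in Filter.atTop, ∀ S : ℕ, sch.L k ≤ S → ∀ m : ℕ, S + 1 ≤ 2 * (m + 2) →
        traceExcess r.ρ (sch.β k) (2 * S + 1) (m + 2) ≤
          C₀ * ((2 * S + 1 : ℕ) : ℝ) ^ 3 * Real.exp (-(Δ * sch.a k * ((m + 2 : ℕ) : ℝ)))) →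
      HasLatticeMassGap r sch Δ :=
  fun _G _ _ _ _ _ _ r sch _Δ _C₀ _K hβ hΔ hC₀ hK hP =>
    hasLatticeMassGap_of_coldPressure r sch hβ hΔ hC₀ hK hP

end Summit.QuantumFields.YangMills.Theorems.WeakCouplingHypercubicLimit.TraceNormColdPressure

end
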